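import Summits.HubbardSuperconductivity.HubbardSuperconductivity.Theorems.AnisotropyChordTransferFibre3ShellIngredients
import Summits.HubbardSuperconductivity.HubbardSuperconductivity.Theorems.AnisotropyChordTransferFibre3LatticeSums

/-!
# Route `AnisotropyChord` / H0 rotor rung: PartN39 — the ℤ² majorant weight of the SHELL MAJORANT and its box sum

First half of the proof of `RateLemma.ShellMajorant` (PORT PartN39, memo 21 §321(a); THEOREMS M137): the weight
`shellWeight` (`S₁`: `θ²(m·r)²/(2ε₁²)`, `S₂`: `θ²(m·r)²/(20ε₁²)`, far: `C_far (m·r)²/|m|⁴`, `C_far = π⁴/(16aθ²)`,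
`a = 2 − 1.5/3.414`), the injective representative map `k ↦ (valMinAbs k₁, valMinAbs k₂)` into the box `|m|∞ ≤ L/2`,
the box sum `Σ_{puncturedBox N} shellWeight ≤ C_far|r|²(4 ln N + 1) + (6/5)θ²|r|²/ε₁²` (`RotationPairing` +
`RingCountBound` + the two explicit shell sums), the constants `2θ²/π² ≤ ε₁ ≤ θ²/2`, and the closing numerics
`(3π⁴/(64a))(4ℓ − 4 ln 2 + 1) + (9/10)π² ≤ 11.71 ℓ + 5.9` (`3.1415 < π < 3.1416`, `ln 2 > 0.6931`).
Prover seat `hubbard-h0-rotor-p2` g0; helper for stmt-HubbardSuperconductivity-19089 (`--supports`, helper class).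
WHAT THIS IS NOT: nothing here proves superconductivity in the Hubbard model; helper lemmas of ONE conditional reduction
(rung 19089, HOLE₂(.75) near-pair tail).  Mathlib + tree imports only; no sorry, no axioms.
-/

set_option linter.dupNamespace false

noncomputable section

namespace Summit.HubbardSuperconductivity.HubbardSuperconductivity.Theorems.AnisotropyChord.Transfer.Fibre3

namespace RateLemma

open Real Finset

variable (L : ℕ) [NeZero L]

/-- the far-shell coefficient `C_far = π⁴/(16 a θ²)`, `a = 2 − 1.5/3.414`, `θ = 2π/L`. -/
def farCoeff : ℝ := Real.pi ^ 4 / (16 * (2 - 1.5 / 3.414) * (2 * Real.pi / L) ^ 2)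

/-- the ℤ² majorant weight of a representative `m` for the target `r = (x,y)`. -/
def shellWeight (x y : ℤ) (m : ℤ × ℤ) : ℝ :=
  if m.1.natAbs + m.2.natAbs = 1 then
    (2 * Real.pi / L) ^ 2 * (((m.1 * x + m.2 * y : ℤ)) : ℝ) ^ 2 / (2 * eps1 L ^ 2)
  else if m.1.natAbs = 1 ∧ m.2.natAbs = 1 then
    (2 * Real.pi / L) ^ 2 * (((m.1 * x + m.2 * y : ℤ)) : ℝ) ^ 2 / (20 * eps1 L ^ 2)
  else farCoeff L * ((((m.1 * x + m.2 * y : ℤ)) : ℝ) ^ 2 / ((((m.1 ^ 2 + m.2 ^ 2 : ℤ)) : ℝ)) ^ 2)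

omit [NeZero L] in
/-- `C_far ≥ 0`. -/
theorem farCoeff_nonneg : 0 ≤ farCoeff L := by
  unfold farCoeff
  have : (0 : ℝ) ≤ 2 - 1.5 / 3.414 := by norm_num
  positivity

omit [NeZero L] in
/-- the weight is nonnegative. -/
theorem shellWeight_nonneg (x y : ℤ) (m : ℤ × ℤ) : 0 ≤ shellWeight L x y m := by
  unfold shellWeight
  have := farCoeff_nonneg L
  split_ifs <;> positivity

/-! ## Basic constants: `θ`, `ε₁` -/

/-- `2θ²/π² ≤ ε₁` (Jordan) for `L ≥ 2`. -/
theorem eps1_ge_jordan (hL : 2 ≤ L) : 2 / Real.pi ^ 2 * (2 * Real.pi / L) ^ 2 ≤ eps1 L := by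
  have h := jordan_wInt L 1 (by exact_mod_cast hL)
  simpa [wInt_one] using h

omit [NeZero L] in
/-- `ε₁ ≤ θ²/2`. -/
theorem eps1_le_half_theta_sq : eps1 L ≤ (2 * Real.pi / L) ^ 2 / 2 := by
  have := Real.one_sub_sq_div_two_le_cos (x := 2 * Real.pi / L)
  unfold eps1; linarith

/-! ## The representative map -/

omit [NeZero L] in
/-- `k ↦ (valMinAbs k₁, valMinAbs k₂)` is injective. -/
theorem rep_injective : Function.Injective (fun k : Tor L => (k.1.valMinAbs, k.2.valMinAbs)) := by
  intro a b h
  simp only [Prod.mk.injEq] at h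
  exact Prod.ext (ZMod.injective_valMinAbs h.1) (ZMod.injective_valMinAbs h.2)

/-- its image lies in the box `|m|∞ ≤ L/2`. -/
theorem rep_mem_box (k : Tor L) :
    (k.1.valMinAbs, k.2.valMinAbs) ∈ (Finset.Icc (-((L / 2 : ℕ) : ℤ)) (L / 2 : ℕ)) ×ˢ
      (Finset.Icc (-((L / 2 : ℕ) : ℤ)) (L / 2 : ℕ)) := by
  simp only [Finset.mem_product, Finset.mem_Icc]
  have h1 := ZMod.natAbs_valMinAbs_le k.1
  have h2 := ZMod.natAbs_valMinAbs_le k.2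
  omega

/-! ## The weight-sum over the punctured box -/

omit [NeZero L] in
/-- the first shell inside the box. -/
theorem filter_shellOne (N : ℕ) (hN : 1 ≤ N) :
    (puncturedBox N).filter (fun m : ℤ × ℤ => m.1.natAbs + m.2.natAbs = 1)
      = {((1 : ℤ), (0 : ℤ)), (-1, 0), (0, 1), (0, -1)} := by
  ext ⟨a, b⟩
  simp only [Finset.mem_filter, mem_puncturedBox, Finset.mem_insert, Finset.mem_singleton, Prod.mk.injEq, ne_eq]
  omega

omit [NeZero L] in
/-- the second shell inside the box. -/
theorem filter_shellTwo (N : ℕ) (hN : 1 ≤ N) :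
    (puncturedBox N).filter (fun m : ℤ × ℤ => m.1.natAbs = 1 ∧ m.2.natAbs = 1)
      = {((1 : ℤ), (1 : ℤ)), (1, -1), (-1, 1), (-1, -1)} := by
  ext ⟨a, b⟩
  simp only [Finset.mem_filter, mem_puncturedBox, Finset.mem_insert, Finset.mem_singleton, Prod.mk.injEq, ne_eq]
  omega

omit [NeZero L] in
/-- the weight splits as `far part + shell corrections`. -/
theorem shellWeight_split (x y : ℤ) (m : ℤ × ℤ) :
    shellWeight L x y m
      = farCoeff L * ((((m.1 * x + m.2 * y : ℤ)) : ℝ) ^ 2 / ((((m.1 ^ 2 + m.2 ^ 2 : ℤ)) : ℝ)) ^ 2)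
        + (if m.1.natAbs + m.2.natAbs = 1 then
            (2 * Real.pi / L) ^ 2 * (((m.1 * x + m.2 * y : ℤ)) : ℝ) ^ 2 / (2 * eps1 L ^ 2)
              - farCoeff L * ((((m.1 * x + m.2 * y : ℤ)) : ℝ) ^ 2 / ((((m.1 ^ 2 + m.2 ^ 2 : ℤ)) : ℝ)) ^ 2)
           else 0)
        + (if m.1.natAbs = 1 ∧ m.2.natAbs = 1 then
            (2 * Real.pi / L) ^ 2 * (((m.1 * x + m.2 * y : ℤ)) : ℝ) ^ 2 / (20 * eps1 L ^ 2)
              - farCoeff L * ((((m.1 * x + m.2 * y : ℤ)) : ℝ) ^ 2 / ((((m.1 ^ 2 + m.2 ^ 2 : ℤ)) : ℝ)) ^ 2)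
           else 0) := by
  unfold shellWeight
  by_cases h1 : m.1.natAbs + m.2.natAbs = 1
  · have h2 : ¬ (m.1.natAbs = 1 ∧ m.2.natAbs = 1) := by omega
    rw [if_pos h1, if_pos h1, if_neg h2]; ring
  · rw [if_neg h1, if_neg h1]
    by_cases h2 : m.1.natAbs = 1 ∧ m.2.natAbs = 1
    · rw [if_pos h2, if_pos h2]; ring
    · rw [if_neg h2, if_neg h2]; ring

omit [NeZero L] in
/-- the explicit first-shell sum. -/
theorem sum_shellOne (x y : ℤ) (A C : ℝ) :
    (∑ m ∈ ({((1 : ℤ), (0 : ℤ)), (-1, 0), (0, 1), (0, -1)} : Finset (ℤ × ℤ)),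
        (A * (((m.1 * x + m.2 * y : ℤ)) : ℝ) ^ 2
          - C * ((((m.1 * x + m.2 * y : ℤ)) : ℝ) ^ 2 / ((((m.1 ^ 2 + m.2 ^ 2 : ℤ)) : ℝ)) ^ 2)))
      = (2 * A - 2 * C) * ((x : ℝ) ^ 2 + (y : ℝ) ^ 2) := by
  rw [Finset.sum_insert (by decide), Finset.sum_insert (by decide), Finset.sum_insert (by decide),
    Finset.sum_singleton]
  push_cast
  ring

omit [NeZero L] in
/-- the explicit second-shell sum. -/
theorem sum_shellTwo (x y : ℤ) (B C : ℝ) :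
    (∑ m ∈ ({((1 : ℤ), (1 : ℤ)), (1, -1), (-1, 1), (-1, -1)} : Finset (ℤ × ℤ)),
        (B * (((m.1 * x + m.2 * y : ℤ)) : ℝ) ^ 2
          - C * ((((m.1 * x + m.2 * y : ℤ)) : ℝ) ^ 2 / ((((m.1 ^ 2 + m.2 ^ 2 : ℤ)) : ℝ)) ^ 2)))
      = (4 * B - C) * ((x : ℝ) ^ 2 + (y : ℝ) ^ 2) := by
  rw [Finset.sum_insert (by decide), Finset.sum_insert (by decide), Finset.sum_insert (by decide),
    Finset.sum_singleton]
  push_cast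
  ring

omit [NeZero L] in
/-- the weight-sum over the punctured box of radius `N ≥ 1`:
`≤ C_far |r|² (4 ln N + 1) + (6/5) θ² |r|² / ε₁²`. -/
theorem sum_shellWeight_le (N : ℕ) (hN : 1 ≤ N) (x y : ℤ) :
    (∑ m ∈ puncturedBox N, shellWeight L x y m)
      ≤ farCoeff L * ((x : ℝ) ^ 2 + (y : ℝ) ^ 2) * (4 * Real.log N + 1)
        + (6 / 5) * (2 * Real.pi / L) ^ 2 * ((x : ℝ) ^ 2 + (y : ℝ) ^ 2) / eps1 L ^ 2 := by
  have hrot := rotationPairing_holds N x y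
  have hring := ringCountBound_holds N hN
  have hCf := farCoeff_nonneg L
  set ρ : ℝ := (x : ℝ) ^ 2 + (y : ℝ) ^ 2 with hρ
  have hρ0 : 0 ≤ ρ := by positivity
  rw [Finset.sum_congr rfl (fun m _ => shellWeight_split L x y m), Finset.sum_add_distrib, Finset.sum_add_distrib]
  -- far part
  have hfar : (∑ m ∈ puncturedBox N,
      farCoeff L * ((((m.1 * x + m.2 * y : ℤ)) : ℝ) ^ 2 / ((((m.1 ^ 2 + m.2 ^ 2 : ℤ)) : ℝ)) ^ 2))
      ≤ farCoeff L * (ρ / 2 * (8 * (Real.log N + 1))) := by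
    rw [← Finset.mul_sum, hrot]
    exact mul_le_mul_of_nonneg_left (mul_le_mul_of_nonneg_left hring (by positivity)) hCf
  -- shell one
  have hs1 : (∑ m ∈ puncturedBox N,
      (if m.1.natAbs + m.2.natAbs = 1 then
        (2 * Real.pi / L) ^ 2 * (((m.1 * x + m.2 * y : ℤ)) : ℝ) ^ 2 / (2 * eps1 L ^ 2)
          - farCoeff L * ((((m.1 * x + m.2 * y : ℤ)) : ℝ) ^ 2 / ((((m.1 ^ 2 + m.2 ^ 2 : ℤ)) : ℝ)) ^ 2)
        else 0))
      = (2 * ((2 * Real.pi / L) ^ 2 / (2 * eps1 L ^ 2)) - 2 * farCoeff L) * ρ := by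
    rw [← Finset.sum_filter, filter_shellOne N hN, ← sum_shellOne x y]
    refine Finset.sum_congr rfl (fun m _ => ?_)
    ring
  -- shell two
  have hs2 : (∑ m ∈ puncturedBox N,
      (if m.1.natAbs = 1 ∧ m.2.natAbs = 1 then
        (2 * Real.pi / L) ^ 2 * (((m.1 * x + m.2 * y : ℤ)) : ℝ) ^ 2 / (20 * eps1 L ^ 2)
          - farCoeff L * ((((m.1 * x + m.2 * y : ℤ)) : ℝ) ^ 2 / ((((m.1 ^ 2 + m.2 ^ 2 : ℤ)) : ℝ)) ^ 2)
        else 0))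
      = (4 * ((2 * Real.pi / L) ^ 2 / (20 * eps1 L ^ 2)) - farCoeff L) * ρ := by
    rw [← Finset.sum_filter, filter_shellTwo N hN, ← sum_shellTwo x y]
    refine Finset.sum_congr rfl (fun m _ => ?_)
    ring
  rw [hs1, hs2]
  have e : farCoeff L * (ρ / 2 * (8 * (Real.log N + 1)))
      + (2 * ((2 * Real.pi / L) ^ 2 / (2 * eps1 L ^ 2)) - 2 * farCoeff L) * ρ
      + (4 * ((2 * Real.pi / L) ^ 2 / (20 * eps1 L ^ 2)) - farCoeff L) * ρ
      = farCoeff L * ρ * (4 * Real.log N + 1) + (6 / 5) * (2 * Real.pi / L) ^ 2 * ρ / eps1 L ^ 2 := by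
    ring
  linarith [hfar, e]

/-! ## The numerical constants -/

omit [NeZero L] in
/-- `(3/2)·(θ²/2)·C_far = 3π⁴/(64a)` and the final numerics: for `ℓ ≥ 0`,
`(3π⁴/(64a))(4ℓ − 4 ln 2 + 1) + (9/10)π² ≤ 11.71 ℓ + 5.9`. -/
theorem numeric_final (ℓ : ℝ) (hℓ : 0 ≤ ℓ) :
    3 * Real.pi ^ 4 / (64 * (2 - 1.5 / 3.414)) * (4 * ℓ - 4 * Real.log 2 + 1) + 9 / 10 * Real.pi ^ 2
      ≤ 11.71 * ℓ + 5.9 := by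
  have hπlo : 3.1415 < Real.pi := Real.pi_gt_d4
  have hπhi : Real.pi < 3.1416 := Real.pi_lt_d4
  have hl2 : 0.6931471803 < Real.log 2 := Real.log_two_gt_d9
  have hπ2lo : 9.869 < Real.pi ^ 2 := by nlinarith
  have hπ2hi : Real.pi ^ 2 < 9.8697 := by nlinarith
  have hπ4lo : 97.39 < Real.pi ^ 4 := by nlinarith
  have hπ4hi : Real.pi ^ 4 < 97.411 := by nlinarith
  set K : ℝ := 3 * Real.pi ^ 4 / (64 * (2 - 1.5 / 3.414)) with hK
  have hKlo : 2.925 < K := by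
    rw [hK, lt_div_iff₀ (by norm_num)]; norm_num; linarith
  have hKhi : K < 2.9259 := by
    rw [hK, div_lt_iff₀ (by norm_num)]; norm_num; linarith
  have h1 : K * (4 * ℓ) ≤ 11.71 * ℓ := by nlinarith
  have h2 : K * (-4 * Real.log 2 + 1) ≤ 2.9259 * 1 - 4 * (2.925 * 0.6931471803) := by nlinarith
  nlinarith

end RateLemma

end Summit.HubbardSuperconductivity.HubbardSuperconductivity.Theorems.AnisotropyChord.Transfer.Fibre3

end
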